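import Summits.HodgeConjecture.HodgeCM.Model.Toy.Duality_2

/-! PORT of `HodgeCM/Model/Toy/Duality.lean` (HodgeCMPerL run 82) — part 3: continuation of `Summits.HodgeConjecture.HodgeCM.Model.Toy.Duality_2` (split at a top-level declaration boundary by port_pkg.py; scope re-opened below; declarations unchanged). -/

-- port_pkg: scope re-opened for this part (file-level context, then the namespace/section stack open at the cut)
noncomputable section
namespace HodgeCM.Toy
open Literature.AlgebraicGeometry.Motives
open Literature.AlgebraicGeometry.Motives.HodgeStructure (EndAction conj ofRat ofRat_apply complexConj
  mem_hodgeClasses_iff)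
open Literature.AlgebraicGeometry.ShimuraVarieties (conjRingHomK embedding_conjRingHomK)
open scoped TensorProduct
open exteriorPower CMPresentation Module
variable (K : CMField) (Φ : Fin 4 → CMType K)
section Esum
variable (K : CMField) (Φ : Fin 4 → CMType K) (k : ℕ)
  (hk : Module.finrank ℚ (PP K Φ).L = k+1+1+1+1)
include hk
/-- (Ported verbatim from the HodgeCMPerL package; no docstring in the source.) -/
lemma vol_mono_ne_zero (u : Fin (k+1+1+1+1) → (PP K Φ).Idx) (hu : Function.Injective u) :
    vol K Φ k hk ((PP K Φ).mono (k+1+1+1+1) u) ≠ 0 := by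
  obtain ⟨σ, hσ⟩ := (PP K Φ).mono_eq_sign_smul_basis u hu
  rw [hσ, eq_topI K Φ k hk ((PP K Φ).imFin u hu), Units.smul_def, map_zsmul, vol,
    Module.Basis.coord_apply, Module.Basis.repr_self, Finsupp.single_eq_same, zsmul_eq_mul, mul_one]
  exact_mod_cast (Equiv.Perm.sign σ).ne_zero

/-- the eigen-sum on a monomial -/
lemma T4_mono (g : Fin k → (PP K Φ).Idx) :
    T4 (vol K Φ k hk) (PP K Φ).eB (fun s => (PP K Φ).eB ((PP K Φ).bar s)) ((PP K Φ).mono k g)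
      = ∑ a, ∑ b, ∑ c, ∑ d, vol K Φ k hk ((PP K Φ).mono (k+1+1+1+1) (ext4 g a b c d))
          • (PP K Φ).mono (1+1+1+1) (q4 ((PP K Φ).bar a) ((PP K Φ).bar b) ((PP K Φ).bar c)
              ((PP K Φ).bar d)) := by
  simp only [T4, W4_mono, W4'_mono]

/-- **Hodge types**: `T4_{e,ē}` maps `F^{p₀} ⋀^{2p₀}` into `F² ⋀⁴`. -/
theorem T4_mem_FF (p₀ : ℕ) (hp : k = 2 * p₀) (z : ⋀[ℂ]^k (PP K Φ).LC)
    (hz : z ∈ (PP K Φ).FF k p₀) :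
    T4 (vol K Φ k hk) (PP K Φ).eB (fun s => (PP K Φ).eB ((PP K Φ).bar s)) z
      ∈ (PP K Φ).FF (1+1+1+1) 2 := by
  have hle : (PP K Φ).FF k p₀ ≤ ((PP K Φ).FF (1+1+1+1) 2).comap
      (T4L (vol K Φ k hk) (PP K Φ).eB (fun s => (PP K Φ).eB ((PP K Φ).bar s))) := by
    unfold Obj.FF
    refine Submodule.span_le.mpr ?_
    rintro _ ⟨g, hg, rfl⟩
    rw [SetLike.mem_coe, Submodule.mem_comap, T4L_apply, T4_mono]
    refine Submodule.sum_mem _ fun a _ => Submodule.sum_mem _ fun b _ =>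
      Submodule.sum_mem _ fun c _ => Submodule.sum_mem _ fun d _ => ?_
    by_cases hinj : Function.Injective (ext4 g a b c d)
    · refine Submodule.smul_mem _ _ (Submodule.subset_span ⟨_, ?_, rfl⟩)
      have h1 := cnt_eq_nhol_univ (ext4 g a b c d) hinj (card_Idx_eq K Φ k hk)
      have h2 := two_mul_nhol_univ (PP K Φ)
      rw [card_Idx_eq K Φ k hk] at h2
      simp only [ext4, Obj.cnt_append] at h1
      have ha := cnt_one_bar (PP K Φ) a
      have hb := cnt_one_bar (PP K Φ) b
      have hc := cnt_one_bar (PP K Φ) c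
      have hd := cnt_one_bar (PP K Φ) d
      have hg' : p₀ ≤ (PP K Φ).cnt g := by exact_mod_cast hg
      have hq : (PP K Φ).cnt (q4 ((PP K Φ).bar a) ((PP K Φ).bar b) ((PP K Φ).bar c) ((PP K Φ).bar d))
          = (PP K Φ).cnt (fun _ : Fin 1 => (PP K Φ).bar a) + (PP K Φ).cnt (fun _ : Fin 1 => (PP K Φ).bar b)
            + (PP K Φ).cnt (fun _ : Fin 1 => (PP K Φ).bar c) + (PP K Φ).cnt (fun _ : Fin 1 => (PP K Φ).bar d) := by
        simp only [q4, Obj.cnt_append]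
      have : 2 ≤ (PP K Φ).cnt (q4 ((PP K Φ).bar a) ((PP K Φ).bar b) ((PP K Φ).bar c) ((PP K Φ).bar d)) := by
        omega
      exact_mod_cast this
    · rw [vol_mono_of_not_injective K Φ k hk _ hinj, zero_smul]
      exact zero_mem _
  have := hle hz
  rw [Submodule.mem_comap, T4L_apply] at this
  exact this

end Esum


/-! ## Part S8: equivariance -/

section Equiv

variable (K : CMField) (Φ : Fin 4 → CMType K)

/-- (Ported verbatim from the HodgeCMPerL package; no docstring in the source.) -/
lemma mulLeft_baseChange {F : Type*} [Field F] [NumberField F] (y : F) (z : ℂ ⊗[ℚ] F) :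
    (LinearMap.mulLeft ℚ y).baseChange ℂ z = ((1 : ℂ) ⊗ₜ[ℚ] y) * z := by
  induction z using TensorProduct.induction_on with
  | zero => simp
  | tmul c x =>
      rw [LinearMap.baseChange_tmul, LinearMap.mulLeft_apply, Algebra.TensorProduct.tmul_mul_tmul,
        one_mul]
  | add x y hx hy => rw [map_add, hx, hy, mul_add]

/-- (Ported verbatim from the HodgeCMPerL package; no docstring in the source.) -/
lemma dμ_comp_single (a : K) (i : (PP K Φ).s.toType) :
    dμ K Φ a ∘ₗ LinearMap.single ℚ (fun j => (((PP K Φ).atom j).F : Type)) i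
      = LinearMap.single ℚ (fun j => (((PP K Φ).atom j).F : Type)) i
          ∘ₗ LinearMap.mulLeft ℚ (cK K Φ a i) := by
  apply LinearMap.ext
  intro y
  simp only [LinearMap.comp_apply, LinearMap.coe_single, LinearMap.mulLeft_apply]
  exact dμ_single K Φ a i y

/-- the eigenvalue of `a` on `e_s` -/
def ev (a : K) (s : (PP K Φ).Idx) : ℂ := s.2 (cK K Φ a s.1)

/-- (Ported verbatim from the HodgeCMPerL package; no docstring in the source.) -/
lemma dμC_eB (a : K) (s : (PP K Φ).Idx) :
    (dμ K Φ a).baseChange ℂ ((PP K Φ).eB s) = ev K Φ a s • (PP K Φ).eB s := by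
  rw [Obj.eB_apply', Obj.eT, ← LinearMap.comp_apply, ← LinearMap.baseChange_comp, dμ_comp_single,
    LinearMap.baseChange_comp, LinearMap.comp_apply, mulLeft_baseChange, tmul_mul_eps, map_smul]
  rfl

/-- (Ported verbatim from the HodgeCMPerL package; no docstring in the source.) -/
lemma map_dμC_mono (a : K) {n : ℕ} (g : Fin n → (PP K Φ).Idx) :
    map n ((dμ K Φ a).baseChange ℂ) ((PP K Φ).mono n g) = (∏ j, ev K Φ a (g j)) • (PP K Φ).mono n g := by
  rw [Obj.mono, map_apply_ιMulti]
  have : ((dμ K Φ a).baseChange ℂ) ∘ (fun j => (PP K Φ).eB (g j)) = fun j => ev K Φ a (g j) • (PP K Φ).eB (g j) := by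
    funext j; exact dμC_eB K Φ a (g j)
  rw [this, AlternatingMap.map_smul_univ]

/-- (Ported verbatim from the HodgeCMPerL package; no docstring in the source.) -/
lemma cK_conj (a : K) (i : (PP K Φ).s.toType) : cK K Φ (conjRingHomK K a) i = cP K Φ i (cK K Φ a i) := by
  rcases i with ((i | i) | i) | i <;> cases i <;> exact (cF_eK K a).symm

/-- (Ported verbatim from the HodgeCMPerL package; no docstring in the source.) -/
lemma ev_bar (a : K) (s : (PP K Φ).Idx) : ev K Φ (conjRingHomK K a) ((PP K Φ).bar s) = ev K Φ a s := by
  obtain ⟨i, τ⟩ := s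
  show (NumberField.ComplexEmbedding.conjugate τ) (cK K Φ (conjRingHomK K a) i) = τ (cK K Φ a i)
  rw [NumberField.ComplexEmbedding.conjugate_coe_eq, cK_conj, emb_cP, starRingEnd_self_apply]

/-- (Ported verbatim from the HodgeCMPerL package; no docstring in the source.) -/
lemma prod_emb_cK (a : K) (i : (PP K Φ).s.toType) :
    ∏ τ : ((PP K Φ).atom i).F →+* ℂ, τ (cK K Φ a i) = ((Algebra.norm ℚ a : ℚ) : ℂ) := by
  have hn : ((Algebra.norm ℚ a : ℚ) : ℂ) = ∏ σ : K →+* ℂ, σ a := by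
    have h := Algebra.norm_eq_prod_embeddings ℚ ℂ a
    rw [eq_ratCast] at h
    rw [h]
    exact Fintype.prod_equiv (RingHom.equivRatAlgHom).symm _ _ (fun σ => rfl)
  rw [hn]
  rcases i with ((i | i) | i) | i <;> cases i <;>
    exact Fintype.prod_equiv (embEquiv K) _ _ (fun τ => rfl)

/-- (Ported verbatim from the HodgeCMPerL package; no docstring in the source.) -/
lemma prod_ev (a : K) : ∏ s : (PP K Φ).Idx, ev K Φ a s = ((Algebra.norm ℚ a : ℚ) : ℂ) ^ 4 := by
  unfold ev
  rw [Fintype.prod_sigma]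
  simp only [prod_emb_cK]
  rw [Finset.prod_const, Finset.card_univ, card_s_PP]

variable (k : ℕ) (hk : Module.finrank ℚ (PP K Φ).L = k+1+1+1+1)
include hk

/-- (Ported verbatim from the HodgeCMPerL package; no docstring in the source.) -/
lemma prod_ev_ext4 (a : K) (g : Fin k → (PP K Φ).Idx) (b₀ b₁ b₂ b₃ : (PP K Φ).Idx)
    (hinj : Function.Injective (ext4 g b₀ b₁ b₂ b₃)) :
    (∏ j, ev K Φ a (g j)) * (ev K Φ a b₀ * ev K Φ a b₁ * ev K Φ a b₂ * ev K Φ a b₃)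
      = ((Algebra.norm ℚ a : ℚ) : ℂ) ^ 4 := by
  have hbij : Function.Bijective (ext4 g b₀ b₁ b₂ b₃) := by
    rw [Fintype.bijective_iff_injective_and_card, Fintype.card_fin, card_Idx_eq K Φ k hk]
    exact ⟨hinj, rfl⟩
  rw [← prod_ev, ← Function.Bijective.prod_comp hbij (ev K Φ a)]
  simp only [ext4, Fin.prod_univ_add, Fin.append_left, Fin.append_right, Fin.prod_univ_one]
  ring

-- heartbeats: the statement itself elaborates slowly (`whnf` of the complexified exterior powers of the
-- model record); the proof is a termwise computation on eigen-monomials (CONTRIBUTING §: ≤ 400000, reason stated).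
set_option maxHeartbeats 400000 in
/-- **Equivariance** of the eigen-sum operator: `μ(ā)^* ∘ T ∘ μ(a)^* = N(a)⁴ · T`. -/
theorem T4L_equivariant (a : K) :
    map (1+1+1+1) ((dμ K Φ (conjRingHomK K a)).baseChange ℂ)
        ∘ₗ T4L (vol K Φ k hk) (PP K Φ).eB (fun s => (PP K Φ).eB ((PP K Φ).bar s))
        ∘ₗ map k ((dμ K Φ a).baseChange ℂ)
      = (((Algebra.norm ℚ a) ^ 4 : ℚ) : ℂ)
          • T4L (vol K Φ k hk) (PP K Φ).eB (fun s => (PP K Φ).eB ((PP K Φ).bar s)) := by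
  apply LinearMap.ext_on_range ((PP K Φ).span_mono_eq_top k)
  intro g
  rw [LinearMap.comp_apply, LinearMap.comp_apply, LinearMap.smul_apply, map_dμC_mono, map_smul,
    T4L_apply, T4_mono, LinearMap.map_smul, map_sum₄, smul_sum₄, smul_sum₄]
  refine Finset.sum_congr rfl fun b₀ _ => Finset.sum_congr rfl fun b₁ _ =>
    Finset.sum_congr rfl fun b₂ _ => Finset.sum_congr rfl fun b₃ _ => ?_
  rw [LinearMap.map_smul, map_dμC_mono]
  simp only [smul_smul]
  congr 1
  by_cases hinj : Function.Injective (ext4 g b₀ b₁ b₂ b₃)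
  · have h := prod_ev_ext4 K Φ k hk a g b₀ b₁ b₂ b₃ hinj
    simp only [q4, Fin.prod_univ_add, Fin.append_left, Fin.append_right, Fin.prod_univ_one, ev_bar]
    rw [Rat.cast_pow, ← h]
    ring
  · rw [vol_mono_of_not_injective K Φ k hk _ hinj]
    simp

/-- (Ported verbatim from the HodgeCMPerL package; no docstring in the source.) -/
lemma theta_DQ_L (y : ⋀[ℚ]^k (PP K Φ).L) :
    (PP K Φ).Θ (1+1+1+1) ((1 : ℂ) ⊗ₜ[ℚ] DQ K Φ k hk y)
      = (cst K Φ k hk)⁻¹ • T4L (vol K Φ k hk) (PP K Φ).eB (fun s => (PP K Φ).eB ((PP K Φ).bar s))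
          ((PP K Φ).Θ k ((1 : ℂ) ⊗ₜ[ℚ] y)) := by
  rw [T4L_apply]
  exact theta_DQ_e K Φ k hk y

-- heartbeats: `isDefEq` through `ℂ ⊗[ℚ] ⋀^n L` / `⋀[ℂ]^n L_ℂ` with the reducible model record is slow; the
-- proof is five short rewrites (CONTRIBUTING §: ≤ 400000, reason stated).
set_option maxHeartbeats 400000 in
/-- **Equivariance of `D`** over `ℚ`. -/
theorem DQ_equivariant (a : K) :
    map (1+1+1+1) (dμ K Φ (conjRingHomK K a)) ∘ₗ DQ K Φ k hk ∘ₗ map k (dμ K Φ a)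
      = ((Algebra.norm ℚ a) ^ 4) • DQ K Φ k hk := by
  apply LinearMap.ext
  intro y
  rw [LinearMap.comp_apply, LinearMap.comp_apply, LinearMap.smul_apply]
  apply ofRat_injective
  apply ((PP K Φ).Θ (1+1+1+1)).injective
  show (PP K Φ).Θ (1+1+1+1) ((1 : ℂ) ⊗ₜ[ℚ] map (1+1+1+1) (dμ K Φ (conjRingHomK K a))
      (DQ K Φ k hk (map k (dμ K Φ a) y)))
    = (PP K Φ).Θ (1+1+1+1) ((1 : ℂ) ⊗ₜ[ℚ] (((Algebra.norm ℚ a) ^ 4) • DQ K Φ k hk y))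
  have e1 : ∀ (n : ℕ) (f : (PP K Φ).L →ₗ[ℚ] (PP K Φ).L) (w : ⋀[ℚ]^n (PP K Φ).L),
      (PP K Φ).Θ n ((1 : ℂ) ⊗ₜ[ℚ] map n f w)
        = map n (f.baseChange ℂ) ((PP K Φ).Θ n ((1 : ℂ) ⊗ₜ[ℚ] w)) := by
    intro n f w
    rw [← LinearMap.baseChange_tmul]
    exact BC.theta_naturality ℚ ℂ (PP K Φ).L n f _
  have h2 := congrArg (fun L => L ((PP K Φ).Θ k ((1 : ℂ) ⊗ₜ[ℚ] y))) (T4L_equivariant K Φ k hk a)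
  rw [LinearMap.comp_apply, LinearMap.comp_apply, LinearMap.smul_apply] at h2
  have e2 : (1 : ℂ) ⊗ₜ[ℚ] (((Algebra.norm ℚ a) ^ 4) • DQ K Φ k hk y)
      = (((Algebra.norm ℚ a) ^ 4 : ℚ) : ℂ) • ((1 : ℂ) ⊗ₜ[ℚ] DQ K Φ k hk y) := by
    rw [← TensorProduct.smul_tmul, Rat.smul_one_eq_cast, TensorProduct.smul_tmul', smul_eq_mul,
      mul_one]
  have e3 : (PP K Φ).Θ (1+1+1+1) ((1 : ℂ) ⊗ₜ[ℚ] (((Algebra.norm ℚ a) ^ 4) • DQ K Φ k hk y))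
      = (((Algebra.norm ℚ a) ^ 4 : ℚ) : ℂ) • ((cst K Φ k hk)⁻¹ • T4L (vol K Φ k hk) (PP K Φ).eB
          (fun s => (PP K Φ).eB ((PP K Φ).bar s)) ((PP K Φ).Θ k ((1 : ℂ) ⊗ₜ[ℚ] y))) := by
    have h3 := congrArg ((PP K Φ).Θ (1+1+1+1)) e2
    rw [LinearEquiv.map_smul, theta_DQ_L] at h3
    exact h3
  have e4 : (PP K Φ).Θ (1+1+1+1) ((1 : ℂ) ⊗ₜ[ℚ] map (1+1+1+1) (dμ K Φ (conjRingHomK K a))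
      (DQ K Φ k hk (map k (dμ K Φ a) y)))
      = (cst K Φ k hk)⁻¹ • ((((Algebra.norm ℚ a) ^ 4 : ℚ) : ℂ) • T4L (vol K Φ k hk) (PP K Φ).eB
          (fun s => (PP K Φ).eB ((PP K Φ).bar s)) ((PP K Φ).Θ k ((1 : ℂ) ⊗ₜ[ℚ] y))) := by
    rw [e1, theta_DQ_L, e1, LinearMap.map_smul, ← h2]
  exact e4.trans ((smul_comm _ _ _).trans e3.symm)

end Equiv

/-! ## Part S9: injectivity of the eigen-sum operator (wedge test) and bijectivity of `D` -/

section MonoBasis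

variable (X : Obj)

/-- (Ported verbatim from the HodgeCMPerL package; no docstring in the source.) -/
lemma q4_eta (v : Fin (1+1+1+1) → X.Idx) : q4 (v 0) (v 1) (v 2) (v 3) = v := by
  funext i
  fin_cases i <;> rfl

/-- (Ported verbatim from the HodgeCMPerL package; no docstring in the source.) -/
lemma q4_bar (a b c d : X.Idx) :
    q4 (X.bar a) (X.bar b) (X.bar c) (X.bar d) = X.bar ∘ q4 a b c d := by
  simp only [q4, BC.comp_append]
  rfl

variable {X} in
/-- (Ported verbatim from the HodgeCMPerL package; no docstring in the source.) -/
lemma mono_ext4 {k : ℕ} (h : Fin k → X.Idx) (a b c d : X.Idx) :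
    X.mono (k+1+1+1+1) (ext4 h a b c d) = X.mono (k + (1+1+1+1)) (Fin.append h (q4 a b c d)) := by
  apply Subtype.ext
  simp only [ext4, q4, ← Obj.coe_mono_mul, mul_assoc]

/-- (Ported verbatim from the HodgeCMPerL package; no docstring in the source.) -/
lemma bar_injective : Function.Injective X.bar :=
  Function.Involutive.injective X.bar_bar

/-- (Ported verbatim from the HodgeCMPerL package; no docstring in the source.) -/
lemma mono_perm {m : ℕ} (v : Fin m → X.Idx) (σ : Equiv.Perm (Fin m)) :
    X.mono m (v ∘ σ) = Equiv.Perm.sign σ • X.mono m v := by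
  rw [Obj.mono_def, Obj.mono_def, ← Function.comp_assoc]
  exact AlternatingMap.map_perm _ _ σ

/-- sorted enumeration of an `m`-subset of indices -/
abbrev enum {m : ℕ} (S : Set.powersetCard X.Idx m) : Fin m → X.Idx :=
  fun i => (Set.powersetCard.ofFinEmbEquiv.symm S) i

/-- (Ported verbatim from the HodgeCMPerL package; no docstring in the source.) -/
lemma basis_eq_mono {m : ℕ} (S : Set.powersetCard X.Idx m) :
    X.eB.exteriorPower m S = X.mono m (enum X S) := by
  rw [exteriorPower.basis_apply, ιMulti_family, Obj.mono_def]

/-- (Ported verbatim from the HodgeCMPerL package; no docstring in the source.) -/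
lemma image_enum {m : ℕ} (S : Set.powersetCard X.Idx m) :
    Finset.univ.image (enum X S) = S.val :=
  Finset.image_orderEmbOfFin_univ S.val S.prop

/-- (Ported verbatim from the HodgeCMPerL package; no docstring in the source.) -/
lemma enum_injective {m : ℕ} (S : Set.powersetCard X.Idx m) : Function.Injective (enum X S) :=
  (Set.powersetCard.ofFinEmbEquiv.symm S).injective

/-- (Ported verbatim from the HodgeCMPerL package; no docstring in the source.) -/
lemma enum_mem {m : ℕ} (S : Set.powersetCard X.Idx m) (i : Fin m) : enum X S i ∈ S.val :=
  Finset.orderEmbOfFin_mem S.val S.prop i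

end MonoBasis

section Comb

variable {α : Type*} [DecidableEq α]

/-- (Ported verbatim from the HodgeCMPerL package; no docstring in the source.) -/
lemma image_append {m l : ℕ} (u : Fin m → α) (w : Fin l → α) :
    Finset.univ.image (Fin.append u w) = Finset.univ.image u ∪ Finset.univ.image w := by
  ext x
  simp only [Finset.mem_image, Finset.mem_univ, true_and, Finset.mem_union]
  constructor
  · rintro ⟨i, rfl⟩
    cases i using Fin.addCases with
    | left j => exact Or.inl ⟨j, (Fin.append_left u w j).symm⟩
    | right j => exact Or.inr ⟨j, (Fin.append_right u w j).symm⟩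
  · rintro (⟨j, rfl⟩ | ⟨j, rfl⟩)
    · exact ⟨Fin.castAdd l j, Fin.append_left u w j⟩
    · exact ⟨Fin.natAdd m j, Fin.append_right u w j⟩

omit [DecidableEq α] in
/-- (Ported verbatim from the HodgeCMPerL package; no docstring in the source.) -/
lemma exists_perm_of_range_eq {m : ℕ} {v v₀ : Fin m → α} (hv : Function.Injective v)
    (hv₀ : Function.Injective v₀) (h : Set.range v = Set.range v₀) :
    ∃ σ : Equiv.Perm (Fin m), v = v₀ ∘ σ := by
  let σ : Equiv.Perm (Fin m) :=
    (Equiv.ofInjective v hv).trans ((Equiv.setCongr h).trans (Equiv.ofInjective v₀ hv₀).symm)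
  refine ⟨σ, funext fun j => ?_⟩
  show v j = v₀ ((Equiv.ofInjective v₀ hv₀).symm (Equiv.setCongr h (Equiv.ofInjective v hv j)))
  exact (Equiv.apply_ofInjective_symm hv₀ (Equiv.setCongr h (Equiv.ofInjective v hv j))).symm

end Comb

section Inj

variable (K : CMField) (Φ : Fin 4 → CMType K) (k : ℕ)
  (hk : Module.finrank ℚ (PP K Φ).L = k+1+1+1+1)
include hk

/-- the test functional `w ↦ vol (e_h ∧ w)` -/
def ψ (h : Fin k → (PP K Φ).Idx) : ⋀[ℂ]^(1+1+1+1) (PP K Φ).LC →ₗ[ℂ] ℂ :=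
  vol K Φ k hk ∘ₗ wedge ℂ (PP K Φ).LC k (1+1+1+1) ((PP K Φ).mono k h)

/-- (Ported verbatim from the HodgeCMPerL package; no docstring in the source.) -/
lemma ψ_mono (h : Fin k → (PP K Φ).Idx) (v : Fin (1+1+1+1) → (PP K Φ).Idx) :
    ψ K Φ k hk h ((PP K Φ).mono (1+1+1+1) v)
      = vol K Φ k hk ((PP K Φ).mono (k + (1+1+1+1)) (Fin.append h v)) := by
  show vol K Φ k hk (wedge ℂ (PP K Φ).LC k (1+1+1+1) ((PP K Φ).mono k h) ((PP K Φ).mono (1+1+1+1) v)) = _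
  rw [Obj.mono_def, Obj.mono_def, BC.wedge_ιMulti, ← BC.comp_append]
  rfl

/-- (Ported verbatim from the HodgeCMPerL package; no docstring in the source.) -/
lemma vol_ext4_eq (g : Fin k → (PP K Φ).Idx) (a b c d : (PP K Φ).Idx) :
    vol K Φ k hk ((PP K Φ).mono (k+1+1+1+1) (ext4 g a b c d))
      = ψ K Φ k hk g ((PP K Φ).mono (1+1+1+1) (q4 a b c d)) := by
  rw [ψ_mono, mono_ext4]

/-- the summand of `ψ_{ḡ'} (T e_g)`, as a function of the 4-tuple -/
def τ (g g' : Fin k → (PP K Φ).Idx) (v : Fin (1+1+1+1) → (PP K Φ).Idx) : ℂ :=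
  ψ K Φ k hk g ((PP K Φ).mono (1+1+1+1) v)
    * ψ K Φ k hk ((PP K Φ).bar ∘ g') ((PP K Φ).mono (1+1+1+1) ((PP K Φ).bar ∘ v))

/-- (Ported verbatim from the HodgeCMPerL package; no docstring in the source.) -/
lemma ψ_T4L_mono (g g' : Fin k → (PP K Φ).Idx) :
    ψ K Φ k hk ((PP K Φ).bar ∘ g')
        (T4L (vol K Φ k hk) (PP K Φ).eB (fun s => (PP K Φ).eB ((PP K Φ).bar s)) ((PP K Φ).mono k g))
      = ∑ a, ∑ b, ∑ c, ∑ d, τ K Φ k hk g g' (q4 a b c d) := by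
  rw [T4L_apply, T4_mono, map_sum₄]
  refine Finset.sum_congr rfl fun a _ => Finset.sum_congr rfl fun b _ =>
    Finset.sum_congr rfl fun c _ => Finset.sum_congr rfl fun d _ => ?_
  rw [LinearMap.map_smul, smul_eq_mul, vol_ext4_eq, q4_bar, τ]

/-- (Ported verbatim from the HodgeCMPerL package; no docstring in the source.) -/
lemma τ_perm (g g' : Fin k → (PP K Φ).Idx) (v : Fin (1+1+1+1) → (PP K Φ).Idx)
    (σ : Equiv.Perm (Fin (1+1+1+1))) : τ K Φ k hk g g' (v ∘ σ) = τ K Φ k hk g g' v := by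
  unfold τ
  rw [show (PP K Φ).bar ∘ (v ∘ σ) = ((PP K Φ).bar ∘ v) ∘ σ from rfl, mono_perm, mono_perm,
    Units.smul_def, Units.smul_def, map_zsmul, map_zsmul, zsmul_eq_mul, zsmul_eq_mul]
  have hs : ((Equiv.Perm.sign σ : ℤ) : ℂ) * ((Equiv.Perm.sign σ : ℤ) : ℂ) = 1 := by
    rw [← Int.cast_mul, ← Units.val_mul, Int.units_mul_self, Units.val_one, Int.cast_one]
  linear_combination (ψ K Φ k hk g ((PP K Φ).mono (1+1+1+1) v)
    * ψ K Φ k hk ((PP K Φ).bar ∘ g') ((PP K Φ).mono (1+1+1+1) ((PP K Φ).bar ∘ v))) * hs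

/-- (Ported verbatim from the HodgeCMPerL package; no docstring in the source.) -/
lemma τ_eq_zero_left {g g' : Fin k → (PP K Φ).Idx} {v : Fin (1+1+1+1) → (PP K Φ).Idx}
    (h : ¬ Function.Injective (Fin.append g v)) : τ K Φ k hk g g' v = 0 := by
  unfold τ
  rw [ψ_mono, vol_mono_of_not_injective K Φ k hk _ h, zero_mul]

/-- (Ported verbatim from the HodgeCMPerL package; no docstring in the source.) -/
lemma τ_eq_zero_right {g g' : Fin k → (PP K Φ).Idx} {v : Fin (1+1+1+1) → (PP K Φ).Idx}
    (h : ¬ Function.Injective (Fin.append g' v)) : τ K Φ k hk g g' v = 0 := by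
  unfold τ
  rw [ψ_mono K Φ k hk ((PP K Φ).bar ∘ g'), ← BC.comp_append,
    vol_mono_of_not_injective K Φ k hk _ (fun hi => h (Function.Injective.of_comp hi)), mul_zero]


-- port_pkg: scope closed for this part
end Inj
end HodgeCM.Toy
end
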